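import Literature.AlgebraicGeometry.Frobenioids.ArchimedeanQuotientLifting
import Literature.AlgebraicGeometry.Frobenioids.ArchimedeanUnitStabilizers
import HarnessLib

/-!
# Frobenioids II, Proposition 3.5 (i) REPAIRED for `C = C₀ ×_{D₀} D` — PROOF (part 2)

Mochizuki, *The geometry of Frobenioids II: poly-Frobenioids*, Kyushu J. Math. **62** (2008) 401–460,
§3, Proposition 3.5 (i), kurims p. 34 [cite: MochizukiFrdII2008, Prop 3.5 (i) p.34]. PROOF-ONLY
companion of `ArchimedeanQuotientLifting.lean` (statement `ArchFrd.Prop35iR`, lift `liftMor`, lifted group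
`liftAutHom`), over ANY functor `π : D → D₀`:
* `isCategoricalQuotient_liftMor` — under Galois saturation the lift `B → A` is a categorical quotient of `B`
  by the lifted group `Γ` in `C` (p. 34 "it follows again from the simple, explicit structure of `H₀` …",
  with the tacit element of `G_D` over complex conjugation made explicit: `D0.act_mem_scalars_of_fixed`);
* `mono_snd_of_mono` — an arrow `ζ : B → B′` under the lift that is a monomorphism for isometric test
  arrows projects to a monomorphism of `D` (the rôle of Prop. 3.4 (ii) in print, proved directly: test
  `ζ` through the pull-back of `B` along `π h₁`; if `π h₁ ≠ π h₂` then `B′`, `A` are real, `B` is isotropic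
  and the scalar of `ζ` is real, so the two test arrows still agree after `ζ`);
* `isMonoMinimalQuotient_liftMor` — mono-minimality (p. 34: `ζ_D` is a mono violating the mono-minimality
  of `B_D → A_D`, hence an iso; then `ζ` is a base-isomorphism and a pull-back morphism, hence an iso by
  [FrdI] Rmk. 1.2.1 = `PreFrobenioid.isPullbackMorphism_and_isBaseIso_iff_isIso`);
* **`prop35iR_C_holds : ArchFrd.Prop35iR_C π`** — Prop. 3.5 (i) for `H = C` under Galois saturation, in the
  exact shape of abc-iut-L1-t9's `Prop35i_C` plus the one hypothesis (finding P35i-F1).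
Nothing here bears on [IUTchIII] Cor. 3.12.
-/

namespace Literature.AlgebraicGeometry.Frobenioids

open CategoryTheory
open scoped Pointwise

noncomputable section

universe v u

namespace ArchFrd

namespace QuotientLift

variable {D : Type u} [Category.{v} D] (π : D ⥤ D0) (A : C π) {BD : D} (fD : BD ⟶ A.snd)
  (GD : Subgroup (Aut BD))

/-! ### Small `D₀` / `C₀` tools -/

/-- Arrows of `D₀` into a real object coincide. [cite: MochizukiFrdII2008, §3 p.23] -/
theorem _root_.Literature.AlgebraicGeometry.Frobenioids.ArchFrd.D0.hom_eq_of_isReal {L K : D0}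
    (hK : K.IsReal) (f g : L ⟶ K) : f = g := by
  unfold D0.IsReal at hK
  subst hK
  exact Subsingleton.elim _ _

/-- `σ` lies over `π f_D` iff it lies over `b = π f_D ≫ α_A⁻¹`. [cite: MochizukiFrdII2008, Prop 3.5 (i) p.34] -/
theorem comp_map_eq_iff (σ : π.obj BD ⟶ π.obj BD) :
    σ ≫ π.map fD = π.map fD ↔ σ ≫ liftBase π A fD = liftBase π A fD := by
  constructor
  · intro h
    change σ ≫ π.map fD ≫ (baseIso π A).inv = π.map fD ≫ (baseIso π A).inv
    rw [← Category.assoc, h]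
  · intro h
    have h' := congrArg (· ≫ (baseIso π A).hom) h
    simpa [liftBase, Category.assoc] using h'

/-! ### `liftMor` is a categorical quotient of `B` by `Γ` (under Galois saturation) -/

section Quotient

variable {GD}
variable (hGD : ∀ g ∈ GD, g.hom ≫ fD = fD)

/-- A `Γ`-invariant arrow out of `B` has `G_D`-invariant `D`-component. [cite: MochizukiFrdI2008, §0 p.18] -/
theorem snd_invariant {X : C π} (ψ : liftObj π A fD ⟶ X)
    (hψ : ∀ γ ∈ (liftAutHom π A fD GD hGD).range, γ.hom ≫ ψ = ψ) (g : Aut BD) (hg : g ∈ GD) :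
    g.hom ≫ ψ.snd = ψ.snd :=
  congrArg CFP.Hom.snd (hψ (liftAutHom π A fD GD hGD ⟨g, hg⟩) ⟨⟨g, hg⟩, rfl⟩)

/-- A `Γ`-invariant arrow out of `B` has `C₀`-scalar fixed by `π(g)` for every `g ∈ G_D`.
[cite: MochizukiFrdII2008, Prop 3.5 (i) p.34] -/
theorem act_scalar_fst_eq {X : C π} (ψ : liftObj π A fD ⟶ X)
    (hψ : ∀ γ ∈ (liftAutHom π A fD GD hGD).range, γ.hom ≫ ψ = ψ) (g : Aut BD) (hg : g ∈ GD) :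
    (π.map g.hom).act (C0.scalar ψ.fst) = C0.scalar ψ.fst := by
  have h : (liftAutHom π A fD GD hGD ⟨g, hg⟩).hom.fst ≫ ψ.fst = ψ.fst :=
    congrArg CFP.Hom.fst (hψ (liftAutHom π A fD GD hGD ⟨g, hg⟩) ⟨⟨g, hg⟩, rfl⟩)
  have hs := congrArg C0.scalar h
  rw [C0.scalar_comp'] at hs
  change (π.map g.hom).act (C0.scalar ψ.fst) * 1 ^ (C0.degFr ψ.fst : ℕ) = C0.scalar ψ.fst at hs
  rwa [one_pow, mul_one] at hs

/-- **`B → A` is a categorical quotient of `B` by `Γ` in `C`** ([FrdI] §0), for a categorical quotient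
`B_D → A_D` by `G_D` in `D` that is Galois-saturated for `π`. [cite: MochizukiFrdII2008, Prop 3.5 (i) p.34] -/
theorem isCategoricalQuotient_liftMor (hq : IsCategoricalQuotient GD fD) (hsat : GaloisSaturated π fD GD) :
    IsCategoricalQuotient (liftAutHom π A fD GD hq.1).range (liftMor π A fD) := by
  refine ⟨?_, ?_⟩
  · rintro γ ⟨g, rfl⟩
    exact liftAut_hom_comp_liftMor π A fD (g : Aut BD) (hq.1 g g.2)
  intro X ψ hψ
  obtain ⟨δ, hδ, hδu⟩ := hq.2 ψ.snd (fun g hg => snd_invariant π A fD hq.1 ψ hψ g hg)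
  set cψ := C0.scalar ψ.fst with hcψ
  set dψ := C0.degFr ψ.fst with hdψ
  let β' : A.fst.base ⟶ X.fst.base := (baseIso π A).hom ≫ π.map δ ≫ (baseIso π X).inv
  have hβ : liftBase π A fD ≫ β' = C0.Base ψ.fst := by
    have w : C0.Base ψ.fst ≫ (baseIso π X).hom = 𝟙 _ ≫ π.map ψ.snd := ψ.w
    have w' : C0.Base ψ.fst ≫ (baseIso π X).hom = π.map fD ≫ π.map δ := by
      rw [← π.map_comp, hδ]
      exact w.trans (Category.id_comp _)
    rw [← cancel_mono (baseIso π X).hom, w']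
    simp only [liftBase, β', Category.assoc, Iso.inv_hom_id_assoc, Iso.inv_hom_id, Category.comp_id]
  have hfix : ∀ σ : π.obj BD ⟶ π.obj BD, σ ≫ liftBase π A fD = liftBase π A fD → σ.act cψ = cψ := by
    intro σ hσ
    obtain ⟨g, hg, hgσ⟩ := hsat σ ((comp_map_eq_iff π A fD σ).2 hσ)
    rw [← hgσ]
    exact act_scalar_fst_eq π A fD hq.1 ψ hψ g hg
  have hc' : (liftBase π A fD).act cψ ∈ D0.scalars A.fst.base :=
    D0.act_mem_scalars_of_fixed (liftBase π A fD) ψ.fst.scalar_mem hfix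
  let ψ₀' : A.fst ⟶ X.fst :=
    { base := β'
      degFr := dψ
      scalar := (liftBase π A fD).act cψ
      scalar_mem := hc'
      mapsTo := by
        have hm : cψ • (C0.pullRegion A.fst (liftBase π A fD)) ^ (dψ : ℕ) ⊆
            (liftBase π A fD).act '' C0.pullRegion X.fst β' := by
          have h0 := (ψ.fst).mapsTo
          rw [← C0.pullRegion_comp, hβ, ← liftRegion_carrier]
          exact h0
        unfold C0.pullRegion at hm ⊢
        have hm' := Set.image_mono (f := (liftBase π A fD).act) hm
        rw [Set.image_smul_distrib, Set.image_pow, C0.act_image_act_image, C0.act_image_act_image] at hm'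
        exact hm' }
  have hfst : liftFst π A fD ≫ ψ₀' = ψ.fst := by
    refine C0.hom_ext hβ ?_ ?_
    · change 1 * dψ = C0.degFr ψ.fst
      rw [one_mul]
    · change (liftBase π A fD).act ((liftBase π A fD).act cψ) * 1 ^ (dψ : ℕ) = C0.scalar ψ.fst
      rw [one_pow, mul_one]
      exact D0.galAct_galAct _ _
  let ψ' : A ⟶ X :=
    { fst := ψ₀'
      snd := δ
      w := by
        change ((baseIso π A).hom ≫ π.map δ ≫ (baseIso π X).inv) ≫ (baseIso π X).hom =
          (baseIso π A).hom ≫ π.map δ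
        simp only [Category.assoc, Iso.inv_hom_id, Category.comp_id] }
  refine ⟨ψ', CFP.hom_ext hfst hδ, ?_⟩
  intro y hy
  have hysnd : y.snd = δ := hδu y.snd (congrArg CFP.Hom.snd hy)
  have hyfst : liftFst π A fD ≫ y.fst = ψ.fst := congrArg CFP.Hom.fst hy
  refine CFP.hom_ext (C0.hom_ext ?_ ?_ ?_) hysnd
  · -- base
    have w : C0.Base y.fst ≫ (baseIso π X).hom = (baseIso π A).hom ≫ π.map y.snd := y.w
    rw [hysnd] at w
    change C0.Base y.fst = (baseIso π A).hom ≫ π.map δ ≫ (baseIso π X).inv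
    rw [← cancel_mono (baseIso π X).hom, w]
    simp only [Category.assoc, Iso.inv_hom_id, Category.comp_id]
  · -- degree
    have hd := congrArg C0.degFr hyfst
    change 1 * C0.degFr y.fst = dψ at hd
    rw [one_mul] at hd
    exact hd
  · -- scalar
    have hs := congrArg C0.scalar hyfst
    rw [C0.scalar_comp'] at hs
    change (liftBase π A fD).act (C0.scalar y.fst) * 1 ^ (C0.degFr y.fst : ℕ) = cψ at hs
    rw [one_pow, mul_one] at hs
    change C0.scalar y.fst = (liftBase π A fD).act cψ
    rw [← hs]
    exact (D0.galAct_galAct _ _).symm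

end Quotient

/-! ### A monomorphism `B → B′` under the lift projects to a monomorphism of `D` -/

/-- An arrow of `D₀` into `Spec ℂ` is an isomorphism. [cite: MochizukiFrdII2008, §3 p.23] -/
theorem isIso_of_target_eq_complex {K L : D0} (f : K ⟶ L) (hL : L = D0.complex) : IsIso f := by
  subst hL
  cases f with
  | gal τ => exact ⟨⟨D0.Hom.gal τ, by cases τ <;> rfl, by cases τ <;> rfl⟩⟩

section MonoSnd

variable {GD} {A' : C π} (ζ : liftObj π A fD ⟶ A') (φ' : A' ⟶ A)
  (hfac : ζ ≫ φ' = liftMor π A fD)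

include hfac

/-- Both factors of `ζ ≫ φ' = liftMor` have linear `C₀`-components. [cite: MochizukiFrdI2008, Def. 1.2(i)] -/
theorem degFr_fst_eq_one_of_fac : C0.degFr ζ.fst = 1 ∧ C0.degFr φ'.fst = 1 := by
  have h : PreFrobenioid.IsLinear C0.toElem (ζ.fst ≫ φ'.fst) := by
    change C0.degFr (ζ.fst ≫ φ'.fst) = 1
    rw [show ζ.fst ≫ φ'.fst = (ζ ≫ φ').fst from rfl, hfac]
    rfl
  have h' := PreFrobenioid.isLinear_factors C0.toElem h
  exact ⟨h'.2, h'.1⟩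

/-- The scalar relation `Base(ζ₀).act(c_{φ'}) · c_ζ = 1`. [cite: MochizukiFrdII2008, Ex 3.3 (i) p.27] -/
theorem scalar_rel_of_fac :
    (C0.Base ζ.fst).act (C0.scalar φ'.fst) * C0.scalar ζ.fst = 1 := by
  have hs : C0.scalar (ζ.fst ≫ φ'.fst) = C0.scalar (liftFst π A fD) := by
    rw [show ζ.fst ≫ φ'.fst = (ζ ≫ φ').fst from rfl, hfac]; rfl
  rw [C0.scalar_comp', (degFr_fst_eq_one_of_fac π A fD ζ φ' hfac).2, PNat.one_coe, pow_one] at hs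
  exact hs

/-- The base relation `Base(ζ₀) ≫ Base(φ'₀) = b`. [cite: MochizukiFrdII2008, Ex 3.3 (i) p.27] -/
theorem base_rel_of_fac : C0.Base ζ.fst ≫ C0.Base φ'.fst = liftBase π A fD := by
  change C0.Base (ζ.fst ≫ φ'.fst) = _
  rw [show ζ.fst ≫ φ'.fst = (ζ ≫ φ').fst from rfl, hfac]
  rfl

omit hfac in
include φ' in
/-- If two distinct arrows of `D₀` into `Spec π(B_D)` have the same composite with `π(ζ_D)`, then `B′`
and `A` are real. [cite: MochizukiFrdII2008, Prop 3.5 (i) p.34] -/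
theorem isReal_of_ne {M : D0} (θ₁ θ₂ : M ⟶ π.obj BD) (hne : θ₁ ≠ θ₂)
    (heq : θ₁ ≫ π.map ζ.snd = θ₂ ≫ π.map ζ.snd) :
    A'.fst.base.IsReal ∧ A.fst.base.IsReal := by
  have hA' : (π.obj A'.snd).IsReal := by
    rcases D0.isReal_or_isComplex (π.obj A'.snd) with h | h
    · exact h
    · exfalso
      haveI : IsIso (π.map ζ.snd) := isIso_of_target_eq_complex _ h
      exact hne ((cancel_mono (π.map ζ.snd)).1 heq)
  have hA'0 : A'.fst.base.IsReal := UnitStab.D0.isReal_of_hom_real A'.iso.inv hA'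
  have hAD : (π.obj A.snd).IsReal := UnitStab.D0.isReal_of_hom_real (π.map φ'.snd) hA'
  exact ⟨hA'0, UnitStab.D0.isReal_of_hom_real A.iso.inv hAD⟩

/-- In that situation the scalar of `ζ₀` is real. [cite: MochizukiFrdII2008, Prop 3.5 (i) p.34] -/
theorem scalar_fst_mem_real (hA' : A'.fst.base.IsReal) : C0.scalar ζ.fst ∈ D0.scalars D0.real := by
  have hcφ : C0.scalar φ'.fst ∈ D0.scalars D0.real := by
    have h := φ'.fst.scalar_mem
    rwa [show A'.fst.base = D0.real from hA'] at h
  have hrel := scalar_rel_of_fac π A fD ζ φ' hfac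
  unfold D0.Hom.act at hrel
  rw [D0.galAct_eq_self_of_mem_scalars_real _ hcφ] at hrel
  rw [eq_inv_of_mul_eq_one_right hrel]
  exact inv_mem hcφ

/-- **An arrow `ζ : B → B′` of `C` with `ζ ≫ φ' = liftMor` that is a monomorphism FOR ISOMETRIC TEST
ARROWS (so: a monomorphism of `C`, or of the angular Frobenioid `A`) projects to a monomorphism `ζ_D` of
`D`** (the rôle of Prop. 3.4 (ii) in the printed proof, done directly for this configuration).
[cite: MochizukiFrdII2008, Prop 3.5 (i) p.34] -/
theorem mono_snd_of_mono
    (hmono : ∀ ⦃T : C π⦄ (t₁ t₂ : T ⟶ liftObj π A fD), PreFrobenioid.IsIsometry (C.toElem π) t₁ →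
      PreFrobenioid.IsIsometry (C.toElem π) t₂ → t₁ ≫ ζ = t₂ ≫ ζ → t₁ = t₂) :
    Mono ζ.snd := by
  refine ⟨fun {Z} h₁ h₂ heq => ?_⟩
  change Z ⟶ BD at h₁ h₂
  have hπ : π.map h₁ ≫ π.map ζ.snd = π.map h₂ ≫ π.map ζ.snd := by
    rw [← π.map_comp, heq, π.map_comp]
  obtain ⟨R₁, hR₁c, hR₁t, -, hR₁i⟩ := exists_pulledRegion (liftC0 π A fD) (π.map h₁)
  have hR₁c2 : R₁.carrier = C0.pullRegion (liftC0 π A fD) (π.map h₂) := by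
    by_cases hθ : π.map h₁ = π.map h₂
    · rw [hR₁c, hθ]
    · have hreal := isReal_of_ne π A fD ζ φ' (π.map h₁) (π.map h₂) hθ hπ
      have hiso : (liftC0 π A fD).region.IsIsotropic :=
        (liftRegion_spec π A fD).2.2.2 (C0.isNaivelyIsotropic_of_isRealObj hreal.2)
      rw [hR₁c]
      unfold C0.pullRegion
      rw [C0.image_galAct_of_isIsotropic hiso, C0.image_galAct_of_isIsotropic hiso]
  let W₁ : C0 := ⟨π.obj Z, R₁, fun h => hR₁i
      ((liftC0 π A fD).isIsotropic_of_isReal (UnitStab.D0.isReal_of_hom_real (π.map h₁) h))⟩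
  let k₁ : W₁ ⟶ liftC0 π A fD :=
    { base := π.map h₁, degFr := 1, scalar := 1, scalar_mem := one_mem _,
      mapsTo := by rw [PNat.one_coe, pow_one, one_smul]; exact hR₁c.le }
  let k₂ : W₁ ⟶ liftC0 π A fD :=
    { base := π.map h₂, degFr := 1, scalar := 1, scalar_mem := one_mem _,
      mapsTo := by rw [PNat.one_coe, pow_one, one_smul]; exact hR₁c2.le }
  let T : C π := ⟨W₁, Z, Iso.refl _⟩
  let t₁ : T ⟶ liftObj π A fD :=
    ⟨k₁, h₁, by change π.map h₁ ≫ 𝟙 _ = 𝟙 _ ≫ π.map h₁; rw [Category.comp_id, Category.id_comp]⟩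
  let t₂ : T ⟶ liftObj π A fD :=
    ⟨k₂, h₂, by change π.map h₂ ≫ 𝟙 _ = 𝟙 _ ≫ π.map h₂; rw [Category.comp_id, Category.id_comp]⟩
  have hiso : ∀ (θ : π.obj Z ⟶ π.obj BD) (hθ : R₁.carrier ⊆ C0.pullRegion (liftC0 π A fD) θ)
      (h : Z ⟶ BD) (hw : θ ≫ 𝟙 _ = 𝟙 _ ≫ π.map h),
      PreFrobenioid.IsIsometry (C.toElem π)
        (⟨{ base := θ, degFr := 1, scalar := 1, scalar_mem := one_mem _,
            mapsTo := by rw [PNat.one_coe, pow_one, one_smul]; exact hθ }, h, hw⟩ :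
          T ⟶ liftObj π A fD) := by
    intro θ hθ h hw
    rw [PreFrobenioid.isIsometry_fiberProduct_iff, A0.isIsometry_iff_norm_mul_tip_pow]
    change ‖((1 : ℂˣ) : ℂ)‖ * (R₁.tip : ℝ) ^ ((1 : ℕ+) : ℕ) = ((liftRegion π A fD).tip : ℝ)
    rw [Units.val_one, norm_one, one_mul, PNat.one_coe, pow_one, hR₁t]
  have ht : t₁ ≫ ζ = t₂ ≫ ζ := by
    refine CFP.hom_ext (C0.hom_ext ?_ rfl ?_) heq
    · change π.map h₁ ≫ C0.Base ζ.fst = π.map h₂ ≫ C0.Base ζ.fst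
      by_cases hθ : π.map h₁ = π.map h₂
      · rw [hθ]
      · exact D0.hom_eq_of_isReal (isReal_of_ne π A fD ζ φ' _ _ hθ hπ).1 _ _
    · change (π.map h₁).act (C0.scalar ζ.fst) * 1 ^ (C0.degFr ζ.fst : ℕ) =
        (π.map h₂).act (C0.scalar ζ.fst) * 1 ^ (C0.degFr ζ.fst : ℕ)
      by_cases hθ : π.map h₁ = π.map h₂
      · rw [hθ]
      · have hcζ := scalar_fst_mem_real π A fD ζ φ' hfac (isReal_of_ne π A fD ζ φ' _ _ hθ hπ).1
        unfold D0.Hom.act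
        rw [D0.galAct_eq_self_of_mem_scalars_real _ hcζ, D0.galAct_eq_self_of_mem_scalars_real _ hcζ]
  have h12 : t₁ = t₂ :=
    hmono t₁ t₂ (hiso (π.map h₁) hR₁c.le h₁ _) (hiso (π.map h₂) hR₁c2.le h₂ _) ht
  exact congrArg CFP.Hom.snd h12

end MonoSnd

/-! ### Mono-minimality and the repaired Proposition 3.5 (i) for `C` -/

/-- **`B → A` is a MONO-MINIMAL categorical quotient of `B` by `Γ` in `C`** whenever `B_D → A_D` is a
mono-minimal categorical quotient by `G_D` in `D` that is Galois-saturated for `π`.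
[cite: MochizukiFrdII2008, Prop 3.5 (i) p.34] -/
theorem isMonoMinimalQuotient_liftMor (hq : IsMonoMinimalQuotient GD fD) (hsat : GaloisSaturated π fD GD) :
    IsMonoMinimalQuotient (liftAutHom π A fD GD hq.1.1).range (liftMor π A fD) := by
  refine ⟨isCategoricalQuotient_liftMor π A fD hq.1 hsat, ?_⟩
  intro A' ζ φ' hfac hmono hgrp
  obtain ⟨Γ', e', he'⟩ := hgrp
  haveI := hmono
  have hmonoD : Mono ζ.snd :=
    mono_snd_of_mono π A fD ζ φ' hfac (fun _ t₁ t₂ _ _ h => (cancel_mono ζ).1 h)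
  haveI := hmonoD
  let eΓ := MonoidHom.ofInjective (liftAutHom_injective π A fD GD hq.1.1)
  let ρ : GD →* Aut A'.snd :=
    ((CFP.proj₂ (PreFrobenioid.baseFunctor C0.toElem) π).mapAut A').comp
      (Γ'.subtype.comp (e'.toMonoidHom.comp eΓ.toMonoidHom))
  have hρ : ∀ g : GD, (g : Aut BD).hom ≫ ζ.snd = ζ.snd ≫ (ρ g).hom := fun g =>
    congrArg CFP.Hom.snd (he' (eΓ g))
  have hρinj : Function.Injective ρ := by
    rw [injective_iff_map_eq_one]
    intro g hg1
    have h := hρ g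
    rw [hg1] at h
    change (g : Aut BD).hom ≫ ζ.snd = ζ.snd ≫ 𝟙 _ at h
    rw [Category.comp_id] at h
    have h' : (g : Aut BD).hom = 𝟙 BD := (cancel_mono ζ.snd).1 (h.trans (Category.id_comp _).symm)
    apply Subtype.ext
    apply Iso.ext
    exact h'
  have hisoD : IsIso ζ.snd :=
    hq.2 ζ.snd φ'.snd (congrArg CFP.Hom.snd hfac) hmonoD
      ⟨ρ.range, MonoidHom.ofInjective hρinj, fun g => hρ g⟩
  haveI := hisoD
  have hbi : PreFrobenioid.IsBaseIso C0.toElem ζ.fst := PreFrobenioid.isBaseIso_fst_of_isIso_snd ζ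
  obtain ⟨hdζ, hdφ⟩ := degFr_fst_eq_one_of_fac π A fD ζ φ' hfac
  have hrel := scalar_rel_of_fac π A fD ζ φ' hfac
  have hbase := base_rel_of_fac π A fD ζ φ' hfac
  have hfull : C0.scalar ζ.fst • (liftC0 π A fD).region.carrier =
      C0.pullRegion A'.fst (C0.Base ζ.fst) := by
    have hmζ := ζ.fst.mapsTo
    change C0.scalar ζ.fst • (liftC0 π A fD).region.carrier ^ (C0.degFr ζ.fst : ℕ) ⊆
      C0.pullRegion A'.fst (C0.Base ζ.fst) at hmζ
    rw [hdζ, PNat.one_coe, pow_one] at hmζ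
    refine Set.Subset.antisymm hmζ ?_
    have hmφ := φ'.fst.mapsTo
    change C0.scalar φ'.fst • A'.fst.region.carrier ^ (C0.degFr φ'.fst : ℕ) ⊆
      C0.pullRegion A.fst (C0.Base φ'.fst) at hmφ
    rw [hdφ, PNat.one_coe, pow_one] at hmφ
    have h1 := Set.image_mono (f := (C0.Base ζ.fst).act) hmφ
    rw [Set.image_smul_distrib] at h1
    change _ ⊆ (C0.Base ζ.fst).act '' C0.pullRegion A.fst (C0.Base φ'.fst) at h1
    rw [← C0.pullRegion_comp, hbase, ← liftRegion_carrier] at h1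
    have h2 := Set.smul_set_mono (a := C0.scalar ζ.fst) h1
    rw [smul_smul, mul_comm, hrel, one_smul] at h2
    exact h2
  have hpb : PreFrobenioid.IsPullbackMorphism C0.toElem ζ.fst :=
    (C0.isPullbackMorphism_iff ζ.fst).2 ⟨hdζ, hfull⟩
  haveI : IsIso ζ.fst :=
    (PreFrobenioid.isPullbackMorphism_and_isBaseIso_iff_isIso C0.toElem ζ.fst).mp ⟨hpb, hbi⟩
  exact CFP.isIso_of_isIso_fst_snd ζ

/-- **Proposition 3.5 (i) for `H = C`, REPAIRED (Galois saturation) — PROVED** over any functor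
`π : D → D₀`: the lift `B := (A_K|_{π B_D}, B_D) → A` is a pull-back morphism of `C` lifting `B_D → A_D`, the
lifted group `Γ ⊆ Aut_C(B)` maps isomorphically to `G_D`, and `B → A` is a mono-minimal categorical quotient
of `B` by `Γ` in `C`. [cite: MochizukiFrdII2008, Prop 3.5 (i) p.34] -/
theorem prop35iR_C_holds : Literature.AlgebraicGeometry.Frobenioids.ArchFrd.Prop35iR_C π := by
  intro _ A BD fD GD hq hsat
  change BD ⟶ A.snd at fD
  refine ⟨liftObj π A fD, liftMor π A fD, Iso.refl _, (liftAutHom π A fD GD hq.1.1).range,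
    (MonoidHom.ofInjective (liftAutHom_injective π A fD GD hq.1.1)).symm,
    isPullbackMorphism_liftMor π A fD, (Category.id_comp _).symm, fun γ => ?_,
    isMonoMinimalQuotient_liftMor π A fD GD hq hsat⟩
  have h1 := MonoidHom.apply_ofInjective_symm (liftAutHom_injective π A fD GD hq.1.1) γ
  have h2 : (((MonoidHom.ofInjective (liftAutHom_injective π A fD GD hq.1.1)).symm γ : GD) : Aut BD).hom =
      (γ : Aut (liftObj π A fD)).hom.snd :=
    congrArg (fun k : Aut (liftObj π A fD) => k.hom.snd) h1
  exact (Category.comp_id _).trans (h2.symm.trans (Category.id_comp _).symm)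

end QuotientLift

end ArchFrd

end

end Literature.AlgebraicGeometry.Frobenioids
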